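import Literature.AlgebraicTopology.CharacteristicClasses.TopologicalChernClassesProofs
import Literature.AlgebraicTopology.SingularHomology.CohomologyRingChange
import Mathlib.Algebra.Field.ZMod
import HarnessLib

/-!
# Reduction modulo two of the Grothendieck Chern classes

D. Husemoller, *Fibre Bundles* (3rd ed. 1994), Ch. 17 §2 Def. 2.6 defines the Chern classes of a
complex vector bundle `ξ` with coefficients in ANY commutative ring `R` through the relation
`aⁿ = -Σ cᵢ(ξ) aⁿ⁻ⁱ` in `H^*(P(ξ); R)`, `a` the class of the tautological line bundle; §3 notes that
the construction is natural, in particular (Ch. 17 Exercise 7; J. Milnor, J. Stasheff,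
*Characteristic Classes* (1974), §14 Problem 14-B) the mod-2 reductions of the integral Chern
classes are the classes of the same construction with `ℤ/2` coefficients (the even Stiefel–Whitney
classes of the underlying real bundle).

For the tree's Grothendieck classes `chernClassR R` (`GrothendieckChernClasses.lean`, defined for every
`R` from the Euler class `x = e(λ) ∈ H²(P(E); R)` of the tautological line bundle, itself defined
through the Thom class `thomClass F E hF R m` of a line bundle normalised by the fibre generators
`ω_b(m)`, `LineThomClassLocal.lean`, `LineEulerClass.lean`) and the change of coefficients
`singularCohomology.ringChange` (`CohomologyRingChange.lean`) along `ℤ → ℤ/2`, this file PROVES the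
compatibility, bottom-up:

* `omegaModel_modTwo`, `omegaFib_modTwo` — the mod-2 reduction of the integral fibre generator
  `ω(1) ∈ H²(ℙ(F ⊕ ℂ); ℤ)` is the `ℤ/2`-generator: it is non-zero (the kernel of the reduction is
  `2H²`, `exists_eq_add_self_of_ringChange_eq_zero`, and `ω(1)` is not divisible by `2`,
  `omegaFibre_bijective`), and `H²(ℙ¹; ℤ/2) = {0, ω(1)}`;
* `thomClass_modTwo`, `eulerClass_modTwo` — for a complex line bundle, `t_{ℤ/2}(1)` is the reduction of
  `t_ℤ(1)` (the reduction is a Thom class: uniqueness `IsThomClass.eq_thomClass`), hence so is the Euler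
  class `e = s₀^* t`;
* `lineEuler_modTwo`, `xClass_modTwo` — the same for the class `x = e(λ)` on `P(E)`;
* `ringChange_cupPow`, `ringChange_lhSum`, `IsChernFamily.ringChange`, `ringChange_degCast` — change of
  coefficients is a ring map compatible with the Leray–Hirsch sums and Chern families;
* **`chernClassR_modTwo`: `cᵢ(E)_{ℤ/2} = ρ₂(cᵢ(E)_ℤ)`** (uniqueness of Chern families,
  `eq_chernClassR_of_isChernFamily`), and `chernClassZ_modTwo` for the tree's integral classes `chernClassZ`.

Everything is proved; no named facts.  Written for Wu's formula (`Sq²` of the Thom class of an almost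
complex `4`-manifold is cup product with `c₁ mod 2`).

## References

* D. Husemoller, *Fibre Bundles*, 3rd ed., GTM 20, Springer 1994, Ch. 17 §2 Def. 2.6, §3, Exercise 7.
  [HusemollerFibreBundles1994]
* J. Milnor, J. Stasheff, *Characteristic Classes*, Ann. of Math. Stud. 76, PUP 1974, §14 Problem 14-B.
  [MilnorStasheff1974]
* A. Hatcher, *Algebraic Topology*, CUP 2002, §3.1 p. 198 (change of coefficients). [HatcherAT2002]
-/

noncomputable section

open CategoryTheory Function Set Bundle Literature.AlgebraicTopology.SingularHomology
open scoped LinearAlgebra.Projectivization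

namespace Literature.AlgebraicTopology.CharacteristicClasses

/-! ### Change of coefficients and the Leray–Hirsch algebra -/

section RingChange

variable {R S : Type} [CommRing R] [CommRing S] (φ : R →+* S) {X' B' : Type} [TopologicalSpace X']
  [TopologicalSpace B']

/-- Change of coefficients commutes with degree casts. [folklore] -/
theorem ringChange_degCast {a b : ℕ} (e : a = b) (y : singularCohomology R R X' a) :
    singularCohomology.ringChange φ X' b (degCast R e y) = degCast S e (singularCohomology.ringChange φ X' a y) := by
  subst e; rfl

/-- Change of coefficients commutes with cup powers: `φ_*(xʲ) = (φ_* x)ʲ`. [cite: HatcherAT2002, §3.2 p. 215] -/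
theorem ringChange_cupPow (x : singularCohomology R R X' 2) :
    ∀ j : ℕ, singularCohomology.ringChange φ X' (2 * j) (cupPow R x j) =
      cupPow S (singularCohomology.ringChange φ X' 2 x) j
  | 0 => ringChange_one φ
  | j + 1 => by
    rw [cupPow_succ, cupPow_succ, singularCohomology.ringChange_cupProduct, ringChange_cupPow x j]

/-- Change of coefficients commutes with the Leray–Hirsch sums `Σⱼ q^*bⱼ ⌣ xʲ`. [cite: HatcherAT2002, §3.2 p. 215] -/
theorem ringChange_lhSum (q : C(X', B')) (x : singularCohomology R R X' 2) {N K : ℕ} (e : Fin N → ℕ)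
    (h : ∀ j, e j + 2 * (j : ℕ) = K) (b : (j : Fin N) → singularCohomology R R B' (e j)) :
    singularCohomology.ringChange φ X' K (lhSum R q x e h b) =
      lhSum S q (singularCohomology.ringChange φ X' 2 x) e h
        (fun j ↦ singularCohomology.ringChange φ B' (e j) (b j)) := by
  rw [lhSum, lhSum, map_sum]
  refine Finset.sum_congr rfl fun j _ ↦ ?_
  rw [singularCohomology.ringChange_cupProduct, ringChange_map, ringChange_cupPow]

/-- **Chern families are preserved by change of coefficients.** [cite: HusemollerFibreBundles1994, Ch. 17 §3] -/
theorem IsChernFamily.ringChange {q : C(X', B')} {x : singularCohomology R R X' 2} {n : ℕ}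
    {c : (i : ℕ) → singularCohomology R R B' (2 * i)} (hc : IsChernFamily R q x n c) :
    IsChernFamily S q (singularCohomology.ringChange φ X' 2 x) n
      (fun i ↦ singularCohomology.ringChange φ B' (2 * i) (c i)) where
  zero := by rw [hc.zero, ringChange_one]
  eq_zero_of_lt i hi := by rw [hc.eq_zero_of_lt i hi, map_zero]
  rel := by
    have h1 := congrArg (singularCohomology.ringChange φ X' (2 * n)) hc.rel
    rw [map_add, map_zero, ringChange_cupPow, ringChange_lhSum] at h1
    exact h1

end RingChange

/-! ### The fibre generator `ω(1)` modulo two -/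

section Model

variable (F : Type) [NormedAddCommGroup F] [NormedSpace ℂ F] (hF : Module.finrank ℂ F = 1)

/-- **The reduction mod 2 of the integral generator `ω(1) ∈ H²(ℙ(F ⊕ ℂ); ℤ)` is the mod-2 generator**:
it is not zero — else `ω(1) = 2y = ω(2a)` (`exists_eq_add_self_of_ringChange_eq_zero`,
`exists_eq_omegaFibre`), i.e. `1 = 2a` in `ℤ` by injectivity of `m ↦ ω(m)` — and the only non-zero
class of `H²(ℙ¹; ℤ/2) ≅ ℤ/2` is `ω(1)`. [cite: HatcherAT2002, §3.1 p. 198 and pp. 199–202] -/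
theorem omegaModel_modTwo :
    singularCohomology.ringChange (Int.castRingHom (ZMod 2)) (ℙ ℂ (F × ℂ)) 2 (omegaModel F hF ℤ ℤ 1) =
      omegaModel F hF (ZMod 2) (ZMod 2) 1 := by
  have hY := modelSphereLike F hF
  obtain ⟨m, hm⟩ := hY.exists_eq_omegaFibre (ZMod 2) (ZMod 2)
    (singularCohomology.ringChange (Int.castRingHom (ZMod 2)) (ℙ ℂ (F × ℂ)) 2 (omegaModel F hF ℤ ℤ 1))
  have hm01 : m = 0 ∨ m = 1 := by
    fin_cases m
    · exact Or.inl rfl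
    · exact Or.inr rfl
  rcases hm01 with rfl | rfl
  · exfalso
    rw [(hY.omegaFibre_eq_zero_iff (ZMod 2) (ZMod 2) 0).2 rfl] at hm
    obtain ⟨y, hy⟩ := exists_eq_add_self_of_ringChange_eq_zero _ hm
    obtain ⟨a, rfl⟩ := hY.exists_eq_omegaFibre ℤ ℤ y
    rw [← hY.omegaFibre_add ℤ ℤ] at hy
    have h1 : (1 : ℤ) = a + a := (hY.omegaFibre_bijective ℤ ℤ).1 hy
    omega
  · exact hm

/-- The same for the fixed model line `ULift ℂ`. [cite: HatcherAT2002, §3.1 p. 198] -/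
theorem omegaStd_modTwo :
    singularCohomology.ringChange (Int.castRingHom (ZMod 2)) (ℙ ℂ (ULift.{0} ℂ × ℂ)) 2 (omegaStd ℤ ℤ 1) =
      omegaStd (ZMod 2) (ZMod 2) 1 :=
  omegaModel_modTwo (ULift.{0} ℂ) finrank_model

end Model

/-! ### Line bundles: the Thom class and the Euler class modulo two -/

section Line

variable {B : Type} [TopologicalSpace B] (F : Type) [NormedAddCommGroup F] [NormedSpace ℂ F] [FiniteDimensional ℂ F]
  (E : B → Type) [∀ b, AddCommGroup (E b)] [∀ b, Module ℂ (E b)]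
  [TopologicalSpace (TotalSpace F E)] [∀ b, TopologicalSpace (E b)] [FiberBundle F E] [VectorBundle ℂ F E]
  (hF : Module.finrank ℂ F = 1)

omit [FiniteDimensional ℂ F] in
/-- **`ρ₂ ω_b(1) = ω_b(1)`**: the fibre generators reduce to the fibre generators. [cite: HatcherAT2002, §3.1 p. 198] -/
theorem omegaFib_modTwo (b : B) :
    singularCohomology.ringChange (Int.castRingHom (ZMod 2)) (ℙ ℂ (E b × ℂ)) 2 (omegaFib F E hF ℤ ℤ b 1) =
      omegaFib F E hF (ZMod 2) (ZMod 2) b 1 := by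
  rw [omegaFib, omegaFib, ringChange_map, omegaStd_modTwo]

variable [T2Space B] [ParacompactSpace B]

/-- **The reduction of the integral Thom class is a `ℤ/2`-Thom class** (both conditions are natural
in the coefficients). [cite: MilnorStasheff1974, §10 Thm. 10.4] -/
theorem isThomClass_ringChange_thomClass :
    IsThomClass F E hF (ZMod 2) 1
      (singularCohomology.ringChange (Int.castRingHom (ZMod 2)) (ProjCompl F E) 2 (thomClass F E hF ℤ 1)) where
  map_complInf := by
    rw [← ringChange_map, (isThomClass_thomClass F E hF ℤ 1).map_complInf, map_zero]
  map_complFibreIncl b := by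
    rw [← ringChange_map, (isThomClass_thomClass F E hF ℤ 1).map_complFibreIncl b, omegaFib_modTwo]

/-- **`t_{ℤ/2}(1) = ρ₂ t_ℤ(1)`** for the Thom class of a complex line bundle (uniqueness of Thom
classes). [cite: MilnorStasheff1974, §10 Thm. 10.4] -/
theorem thomClass_modTwo :
    thomClass F E hF (ZMod 2) 1 =
      singularCohomology.ringChange (Int.castRingHom (ZMod 2)) (ProjCompl F E) 2 (thomClass F E hF ℤ 1) :=
  (isThomClass_ringChange_thomClass F E hF).eq_thomClass.symm

/-- **`e_{ℤ/2}(1) = ρ₂ e_ℤ(1)`**: the mod-2 Euler class (= `w₂` of the underlying real plane bundle) of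
a complex line bundle is the reduction of `c₁ = e_ℤ(1)` (Milnor–Stasheff §14, Problem 14-B for `n = 1`).
[cite: MilnorStasheff1974, §14 Problem 14-B] -/
theorem eulerClass_modTwo :
    eulerClass F E hF (ZMod 2) 1 =
      singularCohomology.ringChange (Int.castRingHom (ZMod 2)) B 2 (eulerClass F E hF ℤ 1) := by
  rw [eulerClass, eulerClass, thomClass_modTwo, ringChange_map]

end Line

/-! ### Complex vector bundles: `x`, the Chern classes -/

namespace ComplexVectorBundle

variable {B : Type} [TopologicalSpace B] [T2Space B] [ParacompactSpace B] (E : ComplexVectorBundle.{0, 0} B)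

/-- `x_{ℤ/2} = ρ₂ x_ℤ` for the Euler class of the tautological line bundle of `P(E)` in any
coordinate. [cite: HusemollerFibreBundles1994, Ch. 17 §2] -/
theorem lineEuler_modTwo (k₀ : Fin E.rank) :
    E.lineEuler k₀ (ZMod 2) 1 =
      singularCohomology.ringChange (Int.castRingHom (ZMod 2)) E.Proj 2 (E.lineEuler k₀ ℤ 1) :=
  eulerClass_modTwo _ _ _

/-- **`x_{ℤ/2} = ρ₂ x_ℤ ∈ H²(P(E); ℤ/2)`.** [cite: HusemollerFibreBundles1994, Ch. 17 §2] -/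
theorem xClass_modTwo (hE : 0 < E.rank) :
    E.xClass (ZMod 2) hE =
      singularCohomology.ringChange (Int.castRingHom (ZMod 2)) E.Proj 2 (E.xClass ℤ hE) :=
  E.lineEuler_modTwo (E.k0 hE)

/-- **`cᵢ(E)_{ℤ/2} = ρ₂ cᵢ(E)_ℤ`**: the Grothendieck Chern classes with `ℤ/2` coefficients are the
mod-2 reductions of the integral ones (Husemoller Ch. 17 §3: the construction of Def. 2.6 is natural
in the coefficient ring; Milnor–Stasheff Problem 14-B). The reductions form a Chern family for
`(q, x_{ℤ/2}, n)` (`IsChernFamily.ringChange`, `xClass_modTwo`), and Chern families are unique.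
[cite: HusemollerFibreBundles1994, Ch. 17 Def. 2.6 and Thm. 2.5] [cite: MilnorStasheff1974, §14 Problem 14-B] -/
theorem chernClassR_modTwo (i : ℕ) :
    E.chernClassR (ZMod 2) i =
      singularCohomology.ringChange (Int.castRingHom (ZMod 2)) B (2 * i) (E.chernClassR ℤ i) := by
  rcases Nat.eq_zero_or_pos E.rank with h0 | hE
  · rcases Nat.eq_zero_or_pos i with rfl | hi
    · rw [E.chernClassR_zero, E.chernClassR_zero, ringChange_one]
    · rw [E.chernClassR_of_rank_eq_zero _ h0 hi.ne', E.chernClassR_of_rank_eq_zero _ h0 hi.ne', map_zero]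
  · have hfam : IsChernFamily (ZMod 2) E.projMap (E.xClass (ZMod 2) hE) E.rank
        (fun i ↦ singularCohomology.ringChange (Int.castRingHom (ZMod 2)) B (2 * i) (E.chernClassR ℤ i)) := by
      rw [E.xClass_modTwo hE]
      exact (E.isChernFamily_chernClassR ℤ hE).ringChange (Int.castRingHom (ZMod 2))
    exact (congrFun (E.eq_chernClassR_of_isChernFamily (ZMod 2) hE hfam) i).symm

end ComplexVectorBundle

/-- **`ρ₂ cᵢ(E) = cᵢ(E)_{ℤ/2}`** for the tree's integral Chern classes `chernClassZ`. [cite: MilnorStasheff1974, §14 Problem 14-B] -/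
theorem chernClassZ_modTwo {B : Type} [TopologicalSpace B] [T2Space B] [ParacompactSpace B]
    (E : ComplexVectorBundle.{0, 0} B) (i : ℕ) :
    singularCohomology.ringChange (Int.castRingHom (ZMod 2)) B (2 * i) (chernClassZ E i) = E.chernClassR (ZMod 2) i := by
  rw [chernClassZ_eq, E.chernClassR_modTwo]

end Literature.AlgebraicTopology.CharacteristicClasses
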